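import Summits.ValiantsHypothesis.ValiantsHypothesis.Theorems.FifoMatchingNNDivisionHardLocatedRowsPairPencil
import HarnessLib

/-!
# LOCATED ROWS — part 4/8 — §4b ★ the CLASS `PinExposed` (a direction maximised over COR on a whole coordinate face `F_S`, `2|S| ≤ n`, with ONE passenger index maximising every tilted row `udRow a + w`, `a ⊆ Sᶜ`) is decided by `pinnedRows.Law`'s body and by `ExactPencilLaw`'s body

Theorems-side port (staged by val-idea-40 g5 for the desk's P-W6b hand; declaration texts VERBATIM, namespace `…Theorems.FifoMatching.LocatedRows`) of val-idea-40 g5's crux workfile `Cruxes/NNDivisionHard/LocatedRows.lean` REV 5 @4b120a7727c3 (sha16 18e097fc3d9fe11e, 1953 l.; critic of record val-idea-crit-9 g2 VERDICTS #48 / #54 / #58: VERIFIED KEEP, axioms standard), split by the 400-line cap into seven chained modules `…RowFamilies` (§1, §2, §4e-frame) → `…LocatedRowsZeroDiag` (§3) → `…LocatedRowsPairPencil` (§4) → `…LocatedRowsPinExposed` (§4b) → `…LocatedRowsColumnCoupled` (§4c) → `…LocatedRowsPermutahedron` (§4c′, §4d) → `…LocatedRowsCeiling` (§5, §5b).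

* `PinExposed`, `pin_block`, `pinnedRows_law_on_pinExposed`, `pinExposed_decided` (xc currency), `pinExposed_qOff`; `exactTilted_law_on_pinExposed` (workfile §4e).

HONEST LABEL: helper rows for an OPEN crux (21181 `NNDivisionHard` OPEN; `ExactPencilLaw`, `allRows.Law`, COR-VIRTUAL OPEN); the `Law`s are `Prop`-valued definitions, nothing open is asserted; VP ≠ VNP is NOT proved.
-/

set_option autoImplicit false

-- the mandated summit-side namespace repeats a component by design (single-problem summit)
set_option linter.dupNamespace false

noncomputable section

open Matrix Finset
open scoped Pointwise

namespace Summit.ValiantsHypothesis.ValiantsHypothesis.Theorems.FifoMatching.LocatedRows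

open Literature.Barriers.PneNP (HasEFOfSize three_pow_le_card_mul_two_pow_of_cover_univ)
open Literature.Combinatorics.Optimization.FixedSizePsdRank (Cube bvec flat vecOuter corPolytope flat_dotProduct_vecOuter
  flat_dotProduct_le_of_mem_corPolytope)
open Summit.ValiantsHypothesis.ValiantsHypothesis.Theorems.FifoMatching.XcDivision
  (udInd udPt udRow udMat udInd_apply udInd_sq udInd_inter ud_data udRow_dotProduct_flat_diagonal flat_dotProduct_flat
    dot_le_of_mem_convexHull)
open Summit.ValiantsHypothesis.Theorems.NNDivisionHardNegative.CliqueRowBlind (sum_udInd_mem sum_udInd_univ)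
open Summit.ValiantsHypothesis.ValiantsHypothesis.Theorems.FifoMatching.GridCorShadow (four_T_lt_two_pow)
open Summit.ValiantsHypothesis.Theorems.NNDivisionHardNegative.DiagTilted
  (qOff qOffMat qOff_eq hasEFOfSize_qOff udRow_dotProduct_qOff udInd_compl udInd_univ)

/-! ## §4b ★ The CLASS behind §4: pin-exposed passengers are decided by C⁺_loc, in Law currency

`Q^∘` is one member of a typed class.  A passenger `q` is PIN-EXPOSED when some direction `w`, maximised over `COR(n)` on the
whole coordinate face `F_S = {x_b : b ⊇ S}` (`2|S| ≤ n`), makes ONE passenger index `j⋆` the maximiser of EVERY tilted row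
`udRow a + w`, `a ⊆ Sᶜ` (a ROW-UNIFORM located maximiser).  Then the rows `(a, (w, S))` of `pinnedRows` and the columns
`(S ∪ b', j⋆)` carry the block `(1 − |a ∩ b'|)²` under the Law's hypotheses, and the Law's conclusion follows at rate
`1.5^{n−|S|}`.  (xc-currency shadow: `w` exposes the face `F_S + {q_{j⋆}}`-like fibre; the Law-currency statement is the one
`pinnedRows.Law` quantifies.)  `Q^∘ ∈ PinExposed` with `S = {i,m}`, `w = n²(E_im+E_mi)`, `j⋆ ↦ [n]∖{i,m}` (`pinExposed_qOff`). -/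

section PinClass
variable {n : ℕ}

/-- CLASS `PinExposed` (Law currency, coordinate faces, row-uniform located maximiser). -/
def PinExposed (n K : ℕ) (q : Fin (K + 1) → (Fin (n * n) → ℝ)) : Prop :=
  ∃ (S : Finset (Fin n)) (w : Fin (n * n) → ℝ) (jstar : Fin (K + 1)),
    2 * S.card ≤ n ∧ (∀ x ∈ corPolytope n, w ⬝ᵥ x ≤ w ⬝ᵥ udPt S) ∧
    (∀ b : Finset (Fin n), S ⊆ b → w ⬝ᵥ udPt b = w ⬝ᵥ udPt S) ∧
    (∀ a : Finset (Fin n), a ⊆ Sᶜ → ∀ j, (udRow a + w) ⬝ᵥ q j ≤ (udRow a + w) ⬝ᵥ q jstar)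

/-- ★★ **THE PIN BLOCK** (general form of `pairPencil_block`): under the three hypotheses of `pinnedRows.Law` for an arbitrary
passenger `q`, pin data `(S, w, j⋆)` yield `3^{n−|S|} ≤ (r+1)·2^{n−|S|}`. -/
theorem pin_block {K r : ℕ} (q : Fin (K + 1) → (Fin (n * n) → ℝ)) (S : Finset (Fin n)) (w : Fin (n * n) → ℝ)
    (jstar : Fin (K + 1)) (hvalid : ∀ x ∈ corPolytope n, w ⬝ᵥ x ≤ w ⬝ᵥ udPt S)
    (htight : ∀ b : Finset (Fin n), S ⊆ b → w ⬝ᵥ udPt b = w ⬝ᵥ udPt S)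
    (hmax : ∀ a : Finset (Fin n), a ⊆ Sᶜ → ∀ j, (udRow a + w) ⬝ᵥ q j ≤ (udRow a + w) ⬝ᵥ q jstar)
    (mm : pinnedRows.A n → ℝ)
    (hle : ∀ a j, pinnedRows.ρ n a ⬝ᵥ q j ≤ mm a) (hat : ∀ a, ∃ j, pinnedRows.ρ n a ⬝ᵥ q j = mm a)
    (U : pinnedRows.A n → Option (Fin r) → ℝ) (V : Finset (Fin n) × Fin (K + 1) → Option (Fin r) → ℝ)
    (hU : ∀ a s, 0 ≤ U a s) (hV : ∀ p s, 0 ≤ V p s)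
    (hfac : ∀ a b j, (pinnedRows.β n a + mm a) - pinnedRows.ρ n a ⬝ᵥ (udPt b + q j) = ∑ s, U a s * V (b, j) s) :
    3 ^ (n - S.card) ≤ (r + 1) * 2 ^ (n - S.card) := by
  classical
  let G : Finset (Fin n) := Sᶜ
  let α := {x : Fin n // x ∈ G}
  have hcardα : Fintype.card α = n - S.card := by
    rw [Fintype.card_coe, Finset.card_compl, Fintype.card_fin]
  let emb : α ↪ Fin n := Function.Embedding.subtype _
  let prow : Finset α → pinnedRows.A n := fun a' => (a'.map emb, ⟨(w, S), hvalid⟩)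
  let col : Finset α → Finset (Fin n) × Fin (K + 1) := fun b' => (S ∪ b'.map emb, jstar)
  have hrowG : ∀ a' : Finset α, a'.map emb ⊆ G := fun a' x hx => by
    obtain ⟨y, -, rfl⟩ := Finset.mem_map.1 hx; exact y.2
  obtain ⟨-, -, slack, -⟩ := ud_data n
  have key := three_pow_le_of_block (ι := Option (Fin r)) U V hU hV prow col ?_
  · rw [hcardα, Fintype.card_option, Fintype.card_fin] at key; exact key
  intro a' b'
  rw [← hfac (prow a') (S ∪ b'.map emb) jstar]
  -- `m` equals the value at `j⋆` on the rows inside `G`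
  have hm : mm (prow a') = (udRow (a'.map emb) + w) ⬝ᵥ q jstar := by
    obtain ⟨j₀, hj₀⟩ := hat (prow a')
    have h1 : (udRow (a'.map emb) + w) ⬝ᵥ q j₀ = mm (prow a') := hj₀
    have h2 : (udRow (a'.map emb) + w) ⬝ᵥ q jstar ≤ mm (prow a') := hle (prow a') jstar
    have h3 := hmax (a'.map emb) (hrowG a') j₀
    rw [h1] at h3
    exact le_antisymm h3 h2
  have hud : udRow (a'.map emb) ⬝ᵥ udPt (S ∪ b'.map emb) = 1 - (1 - (((a' ∩ b').card : ℕ) : ℝ)) ^ 2 := by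
    have := slack (a'.map emb) (S ∪ b'.map emb)
    have hint : a'.map emb ∩ (S ∪ b'.map emb) = (a' ∩ b').map emb := by
      rw [Finset.inter_union_distrib_left, Finset.map_inter]
      have h0 : a'.map emb ∩ S = ∅ := by
        refine Finset.subset_empty.1 fun x hx => ?_
        have hxG := hrowG a' (Finset.mem_inter.1 hx).1
        exact absurd (Finset.mem_inter.1 hx).2 (Finset.mem_compl.1 hxG)
      rw [h0, Finset.empty_union]
    rw [hint, Finset.card_map] at this
    linarith
  have hwb : w ⬝ᵥ udPt (S ∪ b'.map emb) = w ⬝ᵥ udPt S := htight _ Finset.subset_union_left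
  show ((1 + w ⬝ᵥ udPt S) + mm (prow a')) - (udRow (a'.map emb) + w) ⬝ᵥ (udPt (S ∪ b'.map emb) + q jstar)
    = (1 - ((a' ∩ b').card : ℝ)) ^ 2
  rw [hm, dotProduct_add (udRow (a'.map emb) + w) (udPt (S ∪ b'.map emb)) (q jstar),
    add_dotProduct (udRow (a'.map emb)) w (udPt (S ∪ b'.map emb)), hud, hwb]
  ring

/-- rate, general located codimension: `n ≤ 2g ∧ 3^g ≤ (r+1)·2^g ⟹ T c n < r`, eventually in `n`. -/
theorem T_lt_of_block' (c : ℕ) : ∃ n₀ : ℕ, ∀ n ≥ n₀, ∀ g r : ℕ, n ≤ 2 * g → 3 ^ g ≤ (r + 1) * 2 ^ g → T c n < r := by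
  obtain ⟨t₁, ht₁⟩ := four_T_lt_two_pow c (c₀ := 1 / 5) (by norm_num)
  refine ⟨max t₁ 10, fun n hn g r hng hr => ?_⟩
  have hn10 : 10 ≤ n := le_of_max_le_right hn
  have hdiv : n ≤ 5 * (g / 2) := by omega
  have hreal : (1 / 5 : ℝ) * n ≤ ((g / 2 : ℕ) : ℝ) := by
    have : (n : ℝ) ≤ 5 * ((g / 2 : ℕ) : ℝ) := by exact_mod_cast hdiv
    linarith
  have h4 := ht₁ n (le_of_max_le_left hn) (g / 2) hreal
  have hpow : 2 ^ (g / 2) * 2 ^ g ≤ (r + 1) * 2 ^ g := (two_pow_half_mul_le g).trans hr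
  have hle : 2 ^ (g / 2) ≤ r + 1 := Nat.le_of_mul_le_mul_right hpow (Nat.pos_of_ne_zero (by positivity))
  have hT : 1 ≤ T c n := Nat.one_le_two_pow
  unfold T at hT ⊢
  omega

/-- ★★★ **C⁺_loc HOLDS ON THE CLASS `PinExposed`** — `pinnedRows.Law` with its passenger quantifier restricted to pin-exposed
passengers, literal conclusion `T c n < r` (the `HasEFOfSize` budget is not used). -/
theorem pinnedRows_law_on_pinExposed : ∀ c : ℕ, ∃ n₀ : ℕ, ∀ n ≥ n₀,
    ∀ (K : ℕ) (q : Fin (K + 1) → (Fin (n * n) → ℝ)) (r : ℕ), PinExposed n K q →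
    HasEFOfSize (convexHull ℝ (Set.range q)) r →
    ∀ mm : pinnedRows.A n → ℝ, (∀ a j, pinnedRows.ρ n a ⬝ᵥ q j ≤ mm a) →
      (∀ a, ∃ j, pinnedRows.ρ n a ⬝ᵥ q j = mm a) →
    ∀ (U : pinnedRows.A n → Option (Fin r) → ℝ) (V : Finset (Fin n) × Fin (K + 1) → Option (Fin r) → ℝ),
      (∀ a i, 0 ≤ U a i) → (∀ p i, 0 ≤ V p i) →
      (∀ a b j, (pinnedRows.β n a + mm a) - pinnedRows.ρ n a ⬝ᵥ (udPt b + q j) = ∑ i, U a i * V (b, j) i) →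
      T c n < r := by
  intro c
  obtain ⟨n₀, hn₀⟩ := T_lt_of_block' c
  refine ⟨n₀, fun n hn K q r hpin _ mm hle hat U V hU hV hfac => ?_⟩
  obtain ⟨S, w, jstar, hS, hvalid, htight, hmax⟩ := hpin
  exact hn₀ n hn (n - S.card) r (by omega) (pin_block q S w jstar hvalid htight hmax mm hle hat U V hU hV hfac)

/-- ★ `Q^∘ ∈ PinExposed` (`n ≥ 4`): `S = {i,m}`, `w = n²•pv i m`, `j⋆ = e⁻¹([n]∖{i,m})` — the data of §4. -/
theorem pinExposed_qOff (hn : 4 ≤ n) {i m : Fin n} (him : i ≠ m) {K : ℕ} (e : Fin (K + 1) ≃ Finset (Fin n)) :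
    PinExposed n K (qOff ∘ e) := by
  classical
  refine ⟨{i, m}, ((n : ℝ) ^ 2) • pv i m, e.symm ({i, m} : Finset (Fin n))ᶜ, ?_, ?_, ?_, ?_⟩
  · rw [Finset.card_pair him]; omega
  · intro x hx
    rw [smul_dotProduct, smul_dotProduct, smul_eq_mul, smul_eq_mul, pv_dotProduct_udPt_pair him]
    exact mul_le_mul_of_nonneg_left (pv_le_two him x hx) (by positivity)
  · intro b hb
    have hi : i ∈ b := hb (by simp)
    have hm : m ∈ b := hb (by simp)
    rw [smul_dotProduct, smul_dotProduct, smul_eq_mul, smul_eq_mul, pv_dotProduct_udPt_pair him, pv_dotProduct_udPt him,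
      udInd_apply, udInd_apply, if_pos hi, if_pos hm]
    ring
  · intro a ha j
    have h := val_le_val_star him ha (e j)
    have hG : e (e.symm ({i, m} : Finset (Fin n))ᶜ) = ({i, m} : Finset (Fin n))ᶜ := e.apply_symm_apply _
    show val i m a (e j) ≤ (udRow a + ((n : ℝ) ^ 2) • pv i m) ⬝ᵥ qOff (e (e.symm ({i, m} : Finset (Fin n))ᶜ))
    rw [hG]
    exact h

end PinClass

section ExactPin
variable {n : ℕ}

/-- ★★★ **`ExactPencilLaw`'s body HOLDS ON EVERY PIN-EXPOSED PASSENGER** (literal `T c n < r`). -/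
theorem exactTilted_law_on_pinExposed : ∀ c : ℕ, ∃ n₀ : ℕ, ∀ n ≥ n₀,
    ∀ (K : ℕ) (q : Fin (K + 1) → (Fin (n * n) → ℝ)) (r : ℕ), PinExposed n K q →
    HasEFOfSize (convexHull ℝ (Set.range q)) r →
    ∀ mm : exactTilted.A n → ℝ, (∀ a j, exactTilted.ρ n a ⬝ᵥ q j ≤ mm a) →
      (∀ a, ∃ j, exactTilted.ρ n a ⬝ᵥ q j = mm a) →
    ∀ (U : exactTilted.A n → Option (Fin r) → ℝ) (V : Finset (Fin n) × Fin (K + 1) → Option (Fin r) → ℝ),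
      (∀ a i, 0 ≤ U a i) → (∀ p i, 0 ≤ V p i) →
      (∀ a b j, (exactTilted.β n a + mm a) - exactTilted.ρ n a ⬝ᵥ (udPt b + q j) = ∑ i, U a i * V (b, j) i) →
      T c n < r := by
  intro c
  obtain ⟨n₀, hn₀⟩ := pinnedRows_law_on_pinExposed c
  refine ⟨n₀, fun n hn K q r hpin hq => ?_⟩
  exact exact_body_of_pinned_body q (hn₀ n hn K q r hpin hq)


end ExactPin

end Summit.ValiantsHypothesis.ValiantsHypothesis.Theorems.FifoMatching.LocatedRows
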